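import Summits.ResolutionOfSingularities.ResolutionOfSingularities.Theorems.FrobeniusClosingPatchingRelPerfectChartPrincipalStrict
import Summits.ResolutionOfSingularities.ResolutionOfSingularities.Theorems.FrobeniusClosingPatchingRelPerfectChartTransversal
import HarnessLib

/-!
# Crux `PatchingRelPerfect` (stmt-ResolutionOfSingularities-16161), chain w52 — rung toolkit:
# the centre `V(u', φ o)` of a three-letter step is `Spec A/(t, o)` (brick 3)

[OURS · L1 W5.2 · rung tool] Codimension-two centre `c = (t, ℓ)` in a ring `A`, `C` the `ℓ`-chart of
`Bl_{(t,ℓ)} Spec A`, `u' = t/ℓ` the strict transform of `V(t)`, and a second hypersurface `V(o)`.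
Brick 2 (`…ChartPrincipalStrict.lean`) identifies `C/(u')` with `(A/(t))[(ℓ̄)/ℓ̄] = A/(t)` (the
blow-up algebra of a principal ideal at its generator is the bottom subalgebra), the class of `φ r`
going to `r̄`.  Dividing further by `φ o`:

* `quot_bot_blowupAlgebra_equiv` — `A[I/b] ⧸ (r̄) ≅ A ⧸ (r)` when `I ⊆ (b)`, `b` a non-zero-divisor
  (the bottom subalgebra, `Algebra.botEquivOfInjective`);
* `transv_nonempty_quot_pair_equiv` — **`C ⧸ ((u') + (φ o)) ≅ A ⧸ ((t) + (o))`**;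
* `transv_isRegularRing_quot_pair`, `transv_isDomain_quot_pair` — hence the centre
  `V(u', φ o) = (strict transform of V(t)) ∩ (strict transform of V(o))` of the three-letter step is
  REGULAR (resp. integral) as soon as `A/(t, o)` is: with brick 1's quasi-regularity of `(φ o, u')`
  (`transv_isQuasiRegular_pair`) this is exactly the input of stub-1's regular-centre tower
  `isRegular_of_isBlowup_tower` for the next blow-up `V(c', o)` after `V(c, ℓ)` (design note in this
  seat's NOTES: the contact-migration member `x₀x₁ + x₂² + x₃³`).

Arbitrary commutative rings; nothing here is a statement of the manuscript under review.

## References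

* The Stacks Project, Tags 0804, 07Z3, 0BIQ. [StacksProject]
* U. Görtz, T. Wedhorn, *Algebraic Geometry I*, 2nd ed. 2020, Prop. 13.96 (2), (13.19). [GortzWedhorn2020]
-/

-- `Summit.<Summit>.<Sub>.Theorems` with `Sub = Summit` (single-conjunct summit, D-0017)
set_option linter.dupNamespace false

noncomputable section

open CategoryTheory CategoryTheory.Limits AlgebraicGeometry Literature.AlgebraicGeometry.Resolution
open IsLocalRing

namespace Summit.ResolutionOfSingularities.ResolutionOfSingularities.Theorems

namespace ConeRung

universe u

/-! ## Dividing the bottom blow-up algebra by an element of the base -/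

/-- **`R[I/b] ⧸ (r̄) ≅ R ⧸ (r)`** when `I ⊆ (b)` and `b` is a non-zero-divisor: `R[I/b]` is the bottom
subalgebra `≅ R`, and the isomorphism carries `algebraMap r` to `r`. [cite: GortzWedhorn2020, (13.19) p. 415] -/
theorem quot_bot_blowupAlgebra_equiv {R : Type u} [CommRing R] (I : Ideal R) (b : R)
    (hb : b ∈ nonZeroDivisors R) (h : I ≤ Ideal.span {b}) (r : R) :
    Nonempty ((blowupAlgebra I b ⧸ Ideal.span {algebraMap R (blowupAlgebra I b) r}) ≃+*
      (R ⧸ Ideal.span {r})) := by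
  have hinj : Function.Injective (algebraMap R (Localization.Away b)) :=
    IsLocalization.injective (Localization.Away b) (Submonoid.powers_le.mpr hb)
  let e0 : blowupAlgebra I b ≃ₐ[R] (⊥ : Subalgebra R (Localization.Away b)) :=
    Subalgebra.equivOfEq _ _ (blowupAlgebra_eq_bot_of_le_span I b h)
  let e1 : (⊥ : Subalgebra R (Localization.Away b)) ≃ₐ[R] R := Algebra.botEquivOfInjective hinj
  let e : blowupAlgebra I b ≃+* R := (e0.trans e1).toRingEquiv
  have he : e (algebraMap R (blowupAlgebra I b) r) = r := by
    change (e0.trans e1) (algebraMap R (blowupAlgebra I b) r) = r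
    rw [AlgEquiv.commutes]
    rfl
  refine ⟨Ideal.quotientEquiv _ _ e ?_⟩
  rw [Ideal.map_span, Set.image_singleton]
  exact congrArg (fun y => Ideal.span {y}) he.symm

/-! ## The centre `V(u', φ o)` -/

section CodimTwo

variable {A : Type u} [CommRing A] (t ℓ o : A)

local notation3 "cc" => (Fin.cons t (fun _ : Fin 1 => ℓ) : Fin 2 → A)
local notation3 "II" => Ideal.span (Set.range (Fin.cons t (fun _ : Fin 1 => ℓ) : Fin 2 → A))
local notation3 "C" => chartRing cc (Fin.succ 0)
local notation3 "ψ" => chartBase cc (Fin.succ 0)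
local notation3 "u'" => chartGen cc (Fin.succ 0) 0

/-- **`C ⧸ ((u') + (φ o)) ≅ A ⧸ ((t) + (o))`** for the `ℓ`-chart `C` of `Bl_{(t,ℓ)}` (`(t, ℓ)`
quasi-regular with `A/(t, ℓ)` and `A/(t)` domains, `ℓ ∉ (t)`). [cite: GortzWedhorn2020, Prop. 13.96 (2)]
[cite: StacksProject, Tag 0804] -/
theorem transv_nonempty_quot_pair_equiv (hc : IsQuasiRegular cc) [IsDomain (A ⧸ II)]
    [IsDomain (A ⧸ Ideal.span {t})] (hℓ : ℓ ∉ Ideal.span {t}) :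
    Nonempty ((C ⧸ (Ideal.span {u'} ⊔ Ideal.span {ψ o})) ≃+*
      (A ⧸ (Ideal.span {t} ⊔ Ideal.span {o}))) := by
  obtain ⟨e, he⟩ := strictExc_exists_quot_equiv t (fun _ : Fin 1 => ℓ) 0 hc
  have hne : Ideal.Quotient.mk (Ideal.span {t}) (cc (Fin.succ 0)) ≠ 0 := by
    rw [Fin.cons_succ, Ne, Ideal.Quotient.eq_zero_iff_mem]
    exact hℓ
  obtain ⟨e2⟩ := quot_bot_blowupAlgebra_equiv ((II).map (Ideal.Quotient.mk (Ideal.span {t}))) _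
    (mem_nonZeroDivisors_of_ne_zero hne) (map_span_pair_le_span t ℓ)
    (Ideal.Quotient.mk (Ideal.span {t}) o)
  -- `C ⧸ ((u') + (φ o)) ≅ (C ⧸ (u')) ⧸ (φ o) ≅ B ⧸ (ō) ≅ (A/(t)) ⧸ (ō) ≅ A ⧸ ((t) + (o))`
  let e1 := (DoubleQuot.quotQuotEquivQuotSup (Ideal.span {u'}) (Ideal.span {ψ o})).symm
  let e3 := Ideal.quotientEquiv ((Ideal.span {ψ o}).map (Ideal.Quotient.mk (Ideal.span {u'})))
    (Ideal.span {algebraMap (A ⧸ Ideal.span {t}) _ (Ideal.Quotient.mk (Ideal.span {t}) o)}) e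
    (by
      rw [Ideal.map_span _ ({ψ o} : Set C), Set.image_singleton,
        Ideal.map_span _ ({Ideal.Quotient.mk (Ideal.span {u'}) (ψ o)} : Set (C ⧸ Ideal.span {u'})),
        Set.image_singleton]
      change _ = Ideal.span {e (Ideal.Quotient.mk _ (ψ o))}
      rw [he])
  let e4 := DoubleQuot.quotQuotEquivQuotSup (Ideal.span {t}) (Ideal.span {o})
  have h4 : (Ideal.span {o}).map (Ideal.Quotient.mk (Ideal.span {t})) =
      Ideal.span {Ideal.Quotient.mk (Ideal.span {t}) o} := by
    rw [Ideal.map_span, Set.image_singleton]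
  exact ⟨e1.trans (e3.trans (e2.trans ((Ideal.quotEquivOfEq h4.symm).trans e4)))⟩

/-- **The centre of the next step is regular**: `C ⧸ (u', φ o)` is a regular ring when `A ⧸ (t, o)`
is. [cite: GortzWedhorn2020, Prop. 13.96 (2)] -/
theorem transv_isRegularRing_quot_pair (hc : IsQuasiRegular cc) [IsDomain (A ⧸ II)]
    [IsDomain (A ⧸ Ideal.span {t})] (hℓ : ℓ ∉ Ideal.span {t})
    [hreg : IsRegularRing (A ⧸ Ideal.span {t, o})] :
    IsRegularRing (C ⧸ Ideal.span {u', ψ o}) := by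
  obtain ⟨e⟩ := transv_nonempty_quot_pair_equiv t ℓ o hc hℓ
  have h1 : Ideal.span {u', ψ o} = Ideal.span {u'} ⊔ Ideal.span {ψ o} := Ideal.span_insert _ _
  have h2 : Ideal.span {t, o} = Ideal.span {t} ⊔ Ideal.span {o} := Ideal.span_insert _ _
  haveI : IsRegularRing (A ⧸ (Ideal.span {t} ⊔ Ideal.span {o})) :=
    IsRegularRing.of_ringEquiv (Ideal.quotEquivOfEq h2)
  exact IsRegularRing.of_ringEquiv ((Ideal.quotEquivOfEq h1).trans e).symm

/-- **… and integral** when `A ⧸ (t, o)` is a domain. [cite: GortzWedhorn2020, Prop. 13.96 (2)] -/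
theorem transv_isDomain_quot_pair (hc : IsQuasiRegular cc) [IsDomain (A ⧸ II)]
    [IsDomain (A ⧸ Ideal.span {t})] (hℓ : ℓ ∉ Ideal.span {t})
    [hdom : IsDomain (A ⧸ Ideal.span {t, o})] :
    IsDomain (C ⧸ Ideal.span {u', ψ o}) := by
  obtain ⟨e⟩ := transv_nonempty_quot_pair_equiv t ℓ o hc hℓ
  have h1 : Ideal.span {u', ψ o} = Ideal.span {u'} ⊔ Ideal.span {ψ o} := Ideal.span_insert _ _
  have h2 : Ideal.span {t, o} = Ideal.span {t} ⊔ Ideal.span {o} := Ideal.span_insert _ _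
  haveI : IsDomain (A ⧸ (Ideal.span {t} ⊔ Ideal.span {o})) :=
    MulEquiv.isDomain _ (Ideal.quotEquivOfEq h2).symm.toMulEquiv
  exact MulEquiv.isDomain _ ((Ideal.quotEquivOfEq h1).trans e).toMulEquiv

end CodimTwo

end ConeRung

end Summit.ResolutionOfSingularities.ResolutionOfSingularities.Theorems

end
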